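import Summits.MatrixMultiplication.MatrixMultiplication.Theorems.ObstructionDescentUniversalOccurrenceTwoRectangleThreeThreeOneLift
import Summits.MatrixMultiplication.MatrixMultiplication.Theorems.ObstructionDescentUniversalOccurrenceTwoRectangleThreeThreeOneArith

set_option linter.dupNamespace false
set_option autoImplicit false

/-!
# Universal occurrence — two rectangles and the shape `(2N-7,3,3,1)`, part C₂: the value of a non-toggling term (decomp-mm · lens 3 · gen 46)

Route `route-MatrixMultiplication-ObstructionDescent` (sub-problem `MatrixMultiplication`, `ω(ℂ) = 2`); SUPPORT for the crux
`NoOccurrenceObstruction` (`P_O`, item `stmt-MatrixMultiplication-29040`) through the universal-occurrence programme (NODE-g29…g46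
of the decomp-mm cell, lens 3).  Nothing here proves `ω = 2` or closes an item; no `def`, no `sorry`, standard axioms.

**The value law.**  In the design `D″(N)` of part C (positions `q < 2N` in block `q % 2`, slot `q / 2`; double cross `κ` at the
slots `0, 3`, i.e. `κ = (0 1)(6 7)` on positions; lifts `φ(N) = 0, φ(N+1) = 1`, `ψ(N) = 1, ψ(N+1) = 0`; third leg
`γ : 1, 3 ↦ 1`, `2, N+1 ↦ 2`, `N ↦ 3`, else `0`, fed to the polytabloid `e_T` of the tableau `T″` of part A), let `ι` be a
well-formed word (letters `N`, `N+1` exactly at `p_N`, `p_M`) whose term `ζ_e(φ∘ι) · ζ_e((ψ∘ι)∘κ) · e_T(γ∘ι)` is non-zero and which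
does NOT toggle (`p_N`, `p_M` separated in `e` or in the twisted structure).  Then the term equals `-1`
(`threeThreeOne_liftTerm_eq`).  Proof: the product of the two block signs is `+1` exactly when `p_N, p_M` are separated in both
structures (`twist_blockSign_mul`, part `…TwistSign`); `e_T(γ∘ι)` is the product of the signs of the three column readings
(`threeThreeOne_columns`, part C₁); and the rows of the letters satisfy the hypotheses of the finite sign model
`threeThreeOne_model` (part `…ThreeThreeOneArith`): two letter-`2` cells other than `p_M` carry `ι = 2`, two letter-`1` cells other
than the `ι = 1` cell carry `ι = 3`, and equal leg values at distinct positions lie in different blocks because the leg words are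
bijections on blocks.  The model says the total inversion parity is odd iff `p_N, p_M` are separated twice, whence `-1`.

[cite: BurgisserIkenmeyer2011, Thm. 4.4, Lemma 6.1] [cite: BurgisserIkenmeyer2017, §5, Thm. 5.9 (proof of (2)), eq. (3.4)]
-/

noncomputable section

open scoped BigOperators

namespace Summit.MatrixMultiplication.MatrixMultiplication.Theorems.ObstructionCalculus

open Literature.Computability.AlgebraicComplexity
open Literature.NumberTheory.DiophantineGeometry

/-- Sign bookkeeping through an equivalent toggling condition. [folklore] -/
theorem sign_combine' (a b c : ℕ) (S S' : Prop) [Decidable S] [Decidable S'] (hSS : S ↔ S')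
    (h : (a + b + c + (if S' then 1 else 0)) % 2 = 0) :
    (if S then (1 : ℂ) else -1) *
      ((if a % 2 = 0 then (1 : ℂ) else -1) * (if b % 2 = 0 then (1 : ℂ) else -1) * (if c % 2 = 0 then (1 : ℂ) else -1)) =
      -1 := by
  refine sign_combine a b c S (fun hs => ?_) (fun hs => ?_)
  · rw [if_pos (hSS.1 hs)] at h; omega
  · rw [if_neg (fun h' => hs (hSS.2 h'))] at h; omega

set_option maxHeartbeats 800000 in
/-- **Value law for `(2N-7,3,3,1)`.**  A non-vanishing, non-toggling term of the storey sum of the design `D″(N)` equals `-1`.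
[this node] -/
theorem threeThreeOne_liftTerm_eq {N : ℕ} (hN : 5 ≤ N) {Y : YoungDiagram} (hNY : ∀ x ∈ Y.cells, x.1 < N)
    (T : StdFilling (N * 2) Y)
    (hT : ∀ p : Fin (N * 2), T.1 p = (if (p : ℕ) < 4 then ((p : ℕ), 0)
      else if (p : ℕ) < 10 then (((p : ℕ) - 4) % 3, ((p : ℕ) - 4) / 3 + 1) else (0, (p : ℕ) - 7)))
    (e : Fin (N * 2) ≃ Fin 2 × Fin N)
    (hev : ∀ q, (((e q).1 : Fin 2) : ℕ) = (q : ℕ) % 2 ∧ (((e q).2 : Fin N) : ℕ) = (q : ℕ) / 2)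
    {p0 p1 p6 p7 : Fin (N * 2)} (hp0 : (p0 : ℕ) = 0) (hp1 : (p1 : ℕ) = 1) (hp6 : (p6 : ℕ) = 6) (hp7 : (p7 : ℕ) = 7)
    (κ : Equiv.Perm (Fin (N * 2))) (hκ : κ = Equiv.swap p0 p1 * Equiv.swap p6 p7)
    (hκv : ∀ q, ((κ q : Fin (N * 2)) : ℕ) = if (q : ℕ) = 0 then 1 else if (q : ℕ) = 1 then 0
      else if (q : ℕ) = 6 then 7 else if (q : ℕ) = 7 then 6 else (q : ℕ))
    {φ ψ γ : Fin (N + 2) → Fin N}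
    (hφv : ∀ r, ((φ r : Fin N) : ℕ) = if (r : ℕ) < N then (r : ℕ) else (r : ℕ) - N)
    (hψv : ∀ r, ((ψ r : Fin N) : ℕ) = if (r : ℕ) < N then (r : ℕ) else N + 1 - (r : ℕ))
    (hγv : ∀ r, ((γ r : Fin N) : ℕ) = if (r : ℕ) = 1 then 1 else if (r : ℕ) = 2 then 2 else if (r : ℕ) = 3 then 1
      else if (r : ℕ) = N then 3 else if (r : ℕ) = N + 1 then 2 else 0)
    (ι : Fin (N * 2) → Fin (N + 2)) {pN pM : Fin (N * 2)}
    (hpN : ((ι pN : Fin (N + 2)) : ℕ) = N) (hNu : ∀ q, ((ι q : Fin (N + 2)) : ℕ) = N → q = pN)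
    (hpM : ((ι pM : Fin (N + 2)) : ℕ) = N + 1) (hMu : ∀ q, ((ι q : Fin (N + 2)) : ℕ) = N + 1 → q = pM)
    (hsep : (e pN).1 ≠ (e pM).1 ∨ (e (κ pN)).1 ≠ (e (κ pM)).1)
    (hne : wordBlockSign ℂ e (φ ∘ ι) * (wordBlockSign ℂ e ((ψ ∘ ι) ∘ ⇑κ) * T.polytabloid ℂ hNY (γ ∘ ι)) ≠ 0) :
    wordBlockSign ℂ e (φ ∘ ι) * (wordBlockSign ℂ e ((ψ ∘ ι) ∘ ⇑κ) * T.polytabloid ℂ hNY (γ ∘ ι)) = -1 := by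
  classical
  have hx : wordBlockSign ℂ e (φ ∘ ι) ≠ 0 := fun h => hne (by rw [h, zero_mul])
  have hχ : wordBlockSign ℂ e ((ψ ∘ ι) ∘ ⇑κ) ≠ 0 := fun h => hne (by rw [h, zero_mul, mul_zero])
  have hw : T.polytabloid ℂ hNY (γ ∘ ι) ≠ 0 := fun h => hne (by rw [h, mul_zero, mul_zero])
  obtain ⟨harm, -, hlt12, hinj0, hinj1, hinj2⟩ := threeThreeOneTableau_support hNY T hT hw
  obtain ⟨π₀, π₁, π₂, hπ₀, hπ₁, hπ₂, -, hval⟩ := threeThreeOne_columns hNY T hT (by omega) hw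
  /- 1 · letters and leg values -/
  have hwv : ∀ q, (((γ ∘ ι) q : Fin N) : ℕ) = if ((ι q : Fin (N + 2)) : ℕ) = 1 then 1 else if ((ι q : Fin (N + 2)) : ℕ) = 2
      then 2 else if ((ι q : Fin (N + 2)) : ℕ) = 3 then 1 else if ((ι q : Fin (N + 2)) : ℕ) = N then 3
      else if ((ι q : Fin (N + 2)) : ℕ) = N + 1 then 2 else 0 := fun q => hγv (ι q)
  have hxv : ∀ q, (((φ ∘ ι) q : Fin N) : ℕ) = if ((ι q : Fin (N + 2)) : ℕ) < N then ((ι q : Fin (N + 2)) : ℕ)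
      else ((ι q : Fin (N + 2)) : ℕ) - N := fun q => hφv (ι q)
  have hyv : ∀ q, (((ψ ∘ ι) q : Fin N) : ℕ) = if ((ι q : Fin (N + 2)) : ℕ) < N then ((ι q : Fin (N + 2)) : ℕ)
      else N + 1 - ((ι q : Fin (N + 2)) : ℕ) := fun q => hψv (ι q)
  have hw3 : ∀ q, (((γ ∘ ι) q : Fin N) : ℕ) = 3 ↔ ((ι q : Fin (N + 2)) : ℕ) = N := fun q => by
    rw [hwv]; constructor <;> intro h <;> split_ifs at * <;> omega
  have hw2 : ∀ q, (((γ ∘ ι) q : Fin N) : ℕ) = 2 ↔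
      (((ι q : Fin (N + 2)) : ℕ) = 2 ∨ ((ι q : Fin (N + 2)) : ℕ) = N + 1) := fun q => by
    rw [hwv]; constructor <;> intro h <;> split_ifs at * <;> omega
  have hw1 : ∀ q, (((γ ∘ ι) q : Fin N) : ℕ) = 1 ↔
      (((ι q : Fin (N + 2)) : ℕ) = 1 ∨ ((ι q : Fin (N + 2)) : ℕ) = 3) := fun q => by
    rw [hwv]; constructor <;> intro h <;> split_ifs at * <;> omega
  have hx1 : ∀ q, (((φ ∘ ι) q : Fin N) : ℕ) = 1 ↔
      (((ι q : Fin (N + 2)) : ℕ) = 1 ∨ ((ι q : Fin (N + 2)) : ℕ) = N + 1) := fun q => by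
    rw [hxv]; have := (ι q).2; constructor <;> intro h <;> split_ifs at * <;> omega
  have hx2 : ∀ q, (((φ ∘ ι) q : Fin N) : ℕ) = 2 ↔ ((ι q : Fin (N + 2)) : ℕ) = 2 := fun q => by
    rw [hxv]; have := (ι q).2; constructor <;> intro h <;> split_ifs at * <;> omega
  have hx3 : ∀ q, (((φ ∘ ι) q : Fin N) : ℕ) = 3 ↔ ((ι q : Fin (N + 2)) : ℕ) = 3 := fun q => by
    rw [hxv]; have := (ι q).2; constructor <;> intro h <;> split_ifs at * <;> omega
  have hy1 : ∀ q, (((ψ ∘ ι) q : Fin N) : ℕ) = 1 ↔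
      (((ι q : Fin (N + 2)) : ℕ) = 1 ∨ ((ι q : Fin (N + 2)) : ℕ) = N) := fun q => by
    rw [hyv]; have := (ι q).2; constructor <;> intro h <;> split_ifs at * <;> omega
  have hy2 : ∀ q, (((ψ ∘ ι) q : Fin N) : ℕ) = 2 ↔ ((ι q : Fin (N + 2)) : ℕ) = 2 := fun q => by
    rw [hyv]; have := (ι q).2; constructor <;> intro h <;> split_ifs at * <;> omega
  have hy3 : ∀ q, (((ψ ∘ ι) q : Fin N) : ℕ) = 3 ↔ ((ι q : Fin (N + 2)) : ℕ) = 3 := fun q => by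
    rw [hyv]; have := (ι q).2; constructor <;> intro h <;> split_ifs at * <;> omega
  /- 2 · equal leg values at distinct positions lie in different blocks -/
  have hE : ∀ q q' : Fin (N * 2), (e q).1 ≠ (e q').1 ↔ (q : ℕ) % 2 ≠ (q' : ℕ) % 2 := fun q q' => by
    rw [Ne, Fin.ext_iff, (hev q).1, (hev q').1]
  have hxsep : ∀ q q', q ≠ q' → (φ ∘ ι) q = (φ ∘ ι) q' → (q : ℕ) % 2 ≠ (q' : ℕ) % 2 := fun q q' hqq hv hmod =>
    hqq (eq_of_wordBlockSign_ne_zero e hx (Fin.ext (by rw [(hev q).1, (hev q').1, hmod])) hv)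
  have hκκ : ∀ q, κ (κ q) = q := fun q =>
    Fin.ext (by have h1 := hκv q; have h2 := hκv (κ q); split_ifs at h1 h2 <;> omega)
  have hχsep : ∀ q q', q ≠ q' → (ψ ∘ ι) q = (ψ ∘ ι) q' →
      ((κ q : Fin (N * 2)) : ℕ) % 2 ≠ ((κ q' : Fin (N * 2)) : ℕ) % 2 := fun q q' hqq hv hmod => by
    have hcv : ((ψ ∘ ι) ∘ ⇑κ) (κ q) = ((ψ ∘ ι) ∘ ⇑κ) (κ q') := by
      show (ψ ∘ ι) (κ (κ q)) = (ψ ∘ ι) (κ (κ q')); rw [hκκ, hκκ]; exact hv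
    exact hqq (κ.injective (eq_of_wordBlockSign_ne_zero e hχ (Fin.ext (by rw [(hev _).1, (hev _).1, hmod])) hcv))
  /- 3 · columns, cells, rows of the letters -/
  have hcols : ∀ q, 1 ≤ (((γ ∘ ι) q : Fin N) : ℕ) → (q : ℕ) < 10 := fun q hq => by
    by_contra h; have := harm q (by omega); omega
  have hcol0 : ∀ q, 3 ≤ (((γ ∘ ι) q : Fin N) : ℕ) → (q : ℕ) < 4 := fun q hq => by
    by_contra h; have := hlt12 q (by omega) (hcols q (by omega)); omega
  have hcellv0 : ∀ (q : Fin (N * 2)) (ℓ : Fin 4), (q : ℕ) = (π₀.symm ℓ : ℕ) → (((γ ∘ ι) q : Fin N) : ℕ) = (ℓ : ℕ) :=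
    fun q ℓ hq => by
      have h := hπ₀ (π₀.symm ℓ); rw [Equiv.apply_symm_apply] at h
      have hq' : q = ⟨(π₀.symm ℓ : ℕ), by omega⟩ := Fin.ext hq
      rw [hq']; exact h.symm
  have hcellv1 : ∀ (q : Fin (N * 2)) (ℓ : Fin 3), (q : ℕ) = (π₁.symm ℓ : ℕ) + 4 →
      (((γ ∘ ι) q : Fin N) : ℕ) = (ℓ : ℕ) := fun q ℓ hq => by
    have h := hπ₁ (π₁.symm ℓ); rw [Equiv.apply_symm_apply] at h
    have hq' : q = ⟨(π₁.symm ℓ : ℕ) + 4, by omega⟩ := Fin.ext hq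
    rw [hq']; exact h.symm
  have hcellv2 : ∀ (q : Fin (N * 2)) (ℓ : Fin 3), (q : ℕ) = (π₂.symm ℓ : ℕ) + 7 →
      (((γ ∘ ι) q : Fin N) : ℕ) = (ℓ : ℕ) := fun q ℓ hq => by
    have h := hπ₂ (π₂.symm ℓ); rw [Equiv.apply_symm_apply] at h
    have hq' : q = ⟨(π₂.symm ℓ : ℕ) + 7, by omega⟩ := Fin.ext hq
    rw [hq']; exact h.symm
  have hmem : ∀ (k : ℕ) (ℓ4 : Fin 4) (ℓ3 : Fin 3), (ℓ4 : ℕ) = k → (ℓ3 : ℕ) = k → 1 ≤ k → ∀ q : Fin (N * 2),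
      (((γ ∘ ι) q : Fin N) : ℕ) = k →
      (q : ℕ) = (π₀.symm ℓ4 : ℕ) ∨ (q : ℕ) = (π₁.symm ℓ3 : ℕ) + 4 ∨ (q : ℕ) = (π₂.symm ℓ3 : ℕ) + 7 := by
    intro k ℓ4 ℓ3 h4 h3 hk q hq
    have hq10 := hcols q (by omega)
    rcases lt_or_ge (q : ℕ) 4 with hq4 | hq4
    · exact Or.inl (congrArg Fin.val (hinj0 q ⟨(π₀.symm ℓ4 : ℕ), by omega⟩ hq4 (π₀.symm ℓ4).2
        (Fin.ext (by rw [hq, hcellv0 ⟨(π₀.symm ℓ4 : ℕ), by omega⟩ ℓ4 rfl, h4]))))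
    rcases lt_or_ge (q : ℕ) 7 with hq7 | hq7
    · exact Or.inr (Or.inl (congrArg Fin.val (hinj1 q ⟨(π₁.symm ℓ3 : ℕ) + 4, by omega⟩ hq4 hq7
        (by dsimp only; omega) (by have := (π₁.symm ℓ3).2; dsimp only; omega)
        (Fin.ext (by rw [hq, hcellv1 ⟨(π₁.symm ℓ3 : ℕ) + 4, by omega⟩ ℓ3 rfl, h3])))))
    · exact Or.inr (Or.inr (congrArg Fin.val (hinj2 q ⟨(π₂.symm ℓ3 : ℕ) + 7, by omega⟩ hq7 hq10
        (by dsimp only; omega) (by have := (π₂.symm ℓ3).2; dsimp only; omega)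
        (Fin.ext (by rw [hq, hcellv2 ⟨(π₂.symm ℓ3 : ℕ) + 7, by omega⟩ ℓ3 rfl, h3])))))
  have hmem2 := hmem 2 2 2 (by decide) (by decide) (by omega)
  have hmem1 := hmem 1 1 1 (by decide) (by decide) (by omega)
  have hd0 : ∀ a b : Fin 4, a ≠ b → (π₀.symm a : ℕ) ≠ (π₀.symm b : ℕ) := fun a b hab h =>
    hab (π₀.symm.injective (Fin.ext h))
  have hd1 : ∀ a b : Fin 3, a ≠ b → (π₁.symm a : ℕ) ≠ (π₁.symm b : ℕ) := fun a b hab h =>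
    hab (π₁.symm.injective (Fin.ext h))
  have hd2 : ∀ a b : Fin 3, a ≠ b → (π₂.symm a : ℕ) ≠ (π₂.symm b : ℕ) := fun a b hab h =>
    hab (π₂.symm.injective (Fin.ext h))
  -- the `N` cell is the letter-`3` cell of column `0`
  have hwpN : (((γ ∘ ι) pN : Fin N) : ℕ) = 3 := (hw3 pN).2 hpN
  have hnv : (pN : ℕ) = (π₀.symm 3 : ℕ) := congrArg Fin.val
    (hinj0 pN ⟨(π₀.symm 3 : ℕ), by omega⟩ (hcol0 pN (by omega)) (π₀.symm 3).2
      (Fin.ext (by rw [hwpN, hcellv0 ⟨(π₀.symm 3 : ℕ), by omega⟩ 3 rfl]; decide)))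
  have hz0 : (π₀.symm 0 : ℕ) = 6 - (pN : ℕ) - (π₀.symm 2 : ℕ) - (π₀.symm 1 : ℕ) := by
    have := hd0 0 1 (by decide); have := hd0 0 2 (by decide); have := hd0 0 3 (by decide)
    have := hd0 1 2 (by decide); have := hd0 1 3 (by decide); have := hd0 2 3 (by decide)
    have := (π₀.symm 0).2; have := (π₀.symm 1).2; have := (π₀.symm 2).2; have := (π₀.symm 3).2
    omega
  have hz1 : (π₁.symm 0 : ℕ) = 3 - (π₁.symm 2 : ℕ) - (π₁.symm 1 : ℕ) := by
    have := hd1 0 1 (by decide); have := hd1 0 2 (by decide); have := hd1 1 2 (by decide)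
    have := (π₁.symm 0).2; have := (π₁.symm 1).2; have := (π₁.symm 2).2
    omega
  have hz2 : (π₂.symm 0 : ℕ) = 3 - (π₂.symm 2 : ℕ) - (π₂.symm 1 : ℕ) := by
    have := hd2 0 1 (by decide); have := hd2 0 2 (by decide); have := hd2 1 2 (by decide)
    have := (π₂.symm 0).2; have := (π₂.symm 1).2; have := (π₂.symm 2).2
    omega
  -- the `N+1` cell is a letter-`2` cell
  have hwpM : (((γ ∘ ι) pM : Fin N) : ℕ) = 2 := (hw2 pM).2 (Or.inr hpM)
  obtain ⟨jM, hjM3, hjMv⟩ : ∃ jM : ℕ, jM < 3 ∧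
      (if jM = 0 then (π₀.symm 2 : ℕ) else if jM = 1 then (π₁.symm 2 : ℕ) + 4 else (π₂.symm 2 : ℕ) + 7) = (pM : ℕ) := by
    rcases hmem2 pM hwpM with h | h | h
    · exact ⟨0, by omega, by rw [if_pos rfl]; exact h.symm⟩
    · exact ⟨1, by omega, by rw [if_neg (by omega), if_pos rfl]; exact h.symm⟩
    · exact ⟨2, by omega, by rw [if_neg (by omega), if_neg (by omega)]; exact h.symm⟩
  have hMc : (jM = 0 → (pM : ℕ) = (π₀.symm 2 : ℕ)) ∧ (jM = 1 → (pM : ℕ) = (π₁.symm 2 : ℕ) + 4) ∧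
      (jM = 2 → (pM : ℕ) = (π₂.symm 2 : ℕ) + 7) :=
    ⟨fun h => by rw [h] at hjMv; simpa using hjMv.symm, fun h => by rw [h] at hjMv; simpa using hjMv.symm,
      fun h => by rw [h] at hjMv; simpa using hjMv.symm⟩
  have hι2 : ∀ C, (((γ ∘ ι) C : Fin N) : ℕ) = 2 → C ≠ pM → ((ι C : Fin (N + 2)) : ℕ) = 2 := fun C hC hCM =>
    ((hw2 C).1 hC).resolve_right fun h => hCM (hMu C h)
  -- the `ι = 1` cell: the `φ∘ι = 1` cell of the block not containing `p_M`
  obtain ⟨b', hb'⟩ : ∃ b : Fin 2, b ≠ (e pM).1 := by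
    have h : ∀ a : Fin 2, ∃ b : Fin 2, b ≠ a := by decide
    exact h _
  obtain ⟨j, hj⟩ := (bijective_of_wordBlockSign_ne_zero e hx b').2 ⟨1, by omega⟩
  obtain ⟨one, hone⟩ : ∃ q : Fin (N * 2), q = e.symm (b', j) := ⟨_, rfl⟩
  have hx1one : (((φ ∘ ι) one : Fin N) : ℕ) = 1 := by rw [hone]; exact congrArg Fin.val hj
  have honeblk : (e one).1 = b' := by rw [hone, Equiv.apply_symm_apply]
  have honeM : one ≠ pM := fun h => hb' (by rw [← honeblk, h])
  have hιone : ((ι one : Fin (N + 2)) : ℕ) = 1 := ((hx1 one).1 hx1one).resolve_right fun h => honeM (hMu one h)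
  have hwone : (((γ ∘ ι) one : Fin N) : ℕ) = 1 := (hw1 one).2 (Or.inl hιone)
  have hNone : pN ≠ one := fun h => by rw [h, hιone] at hpN; omega
  have hι3 : ∀ O, (((γ ∘ ι) O : Fin N) : ℕ) = 1 → O ≠ one → ((ι O : Fin (N + 2)) : ℕ) = 3 := fun O hO hOne => by
    rcases (hw1 O).1 hO with h | h
    · exfalso
      have hxO : (((φ ∘ ι) O : Fin N) : ℕ) = 1 := (hx1 O).2 (Or.inl h)
      have hOM : O ≠ pM := fun h' => by rw [h', hpM] at h; omega
      have h1 := hxsep O one hOne (Fin.ext (by rw [hxO, hx1one]))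
      have h2 := hxsep O pM hOM (Fin.ext (by rw [hxO, (hx1 pM).2 (Or.inr hpM)]))
      have h3 := (hE one pM).1 (by rw [honeblk]; exact hb')
      omega
    · exact h
  obtain ⟨j1, hj13, hj1v⟩ : ∃ j1 : ℕ, j1 < 3 ∧
      (if j1 = 0 then (π₀.symm 1 : ℕ) else if j1 = 1 then (π₁.symm 1 : ℕ) + 4 else (π₂.symm 1 : ℕ) + 7) = (one : ℕ) := by
    rcases hmem1 one hwone with h | h | h
    · exact ⟨0, by omega, by rw [if_pos rfl]; exact h.symm⟩
    · exact ⟨1, by omega, by rw [if_neg (by omega), if_pos rfl]; exact h.symm⟩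
    · exact ⟨2, by omega, by rw [if_neg (by omega), if_neg (by omega)]; exact h.symm⟩
  have hOc : (j1 = 0 → (one : ℕ) = (π₀.symm 1 : ℕ)) ∧ (j1 = 1 → (one : ℕ) = (π₁.symm 1 : ℕ) + 4) ∧
      (j1 = 2 → (one : ℕ) = (π₂.symm 1 : ℕ) + 7) :=
    ⟨fun h => by rw [h] at hj1v; simpa using hj1v.symm, fun h => by rw [h] at hj1v; simpa using hj1v.symm,
      fun h => by rw [h] at hj1v; simpa using hj1v.symm⟩
  /- 4 · the letter-`2` and letter-`1` cells and the pair facts -/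
  obtain ⟨C0, hC0⟩ : ∃ q : Fin (N * 2), (q : ℕ) = (π₀.symm 2 : ℕ) := ⟨⟨(π₀.symm 2 : ℕ), by omega⟩, rfl⟩
  obtain ⟨C1, hC1⟩ : ∃ q : Fin (N * 2), (q : ℕ) = (π₁.symm 2 : ℕ) + 4 := ⟨⟨(π₁.symm 2 : ℕ) + 4, by omega⟩, rfl⟩
  obtain ⟨C2, hC2⟩ : ∃ q : Fin (N * 2), (q : ℕ) = (π₂.symm 2 : ℕ) + 7 := ⟨⟨(π₂.symm 2 : ℕ) + 7, by omega⟩, rfl⟩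
  obtain ⟨O0, hO0⟩ : ∃ q : Fin (N * 2), (q : ℕ) = (π₀.symm 1 : ℕ) := ⟨⟨(π₀.symm 1 : ℕ), by omega⟩, rfl⟩
  obtain ⟨O1, hO1⟩ : ∃ q : Fin (N * 2), (q : ℕ) = (π₁.symm 1 : ℕ) + 4 := ⟨⟨(π₁.symm 1 : ℕ) + 4, by omega⟩, rfl⟩
  obtain ⟨O2, hO2⟩ : ∃ q : Fin (N * 2), (q : ℕ) = (π₂.symm 1 : ℕ) + 7 := ⟨⟨(π₂.symm 1 : ℕ) + 7, by omega⟩, rfl⟩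
  have hwC0 : (((γ ∘ ι) C0 : Fin N) : ℕ) = 2 := (hcellv0 C0 2 hC0).trans (by decide)
  have hwC1 : (((γ ∘ ι) C1 : Fin N) : ℕ) = 2 := (hcellv1 C1 2 hC1).trans (by decide)
  have hwC2 : (((γ ∘ ι) C2 : Fin N) : ℕ) = 2 := (hcellv2 C2 2 hC2).trans (by decide)
  have hwO0 : (((γ ∘ ι) O0 : Fin N) : ℕ) = 1 := (hcellv0 O0 1 hO0).trans (by decide)
  have hwO1 : (((γ ∘ ι) O1 : Fin N) : ℕ) = 1 := (hcellv1 O1 1 hO1).trans (by decide)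
  have hwO2 : (((γ ∘ ι) O2 : Fin N) : ℕ) = 1 := (hcellv2 O2 1 hO2).trans (by decide)
  have b02 := (π₀.symm 2).2; have b01 := (π₀.symm 1).2; have b12 := (π₁.symm 2).2
  have b11 := (π₁.symm 1).2; have b22 := (π₂.symm 2).2; have b21 := (π₂.symm 1).2
  have pair2 : ∀ C C' : Fin (N * 2), (((γ ∘ ι) C : Fin N) : ℕ) = 2 → (((γ ∘ ι) C' : Fin N) : ℕ) = 2 →
      (C : ℕ) ≠ (C' : ℕ) → (C : ℕ) ≠ (pM : ℕ) → (C' : ℕ) ≠ (pM : ℕ) →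
      (C : ℕ) % 2 ≠ (C' : ℕ) % 2 ∧ ((κ C : Fin (N * 2)) : ℕ) % 2 ≠ ((κ C' : Fin (N * 2)) : ℕ) % 2 :=
    fun C C' hC hC' hCC hCM hC'M => by
      have hne : C ≠ C' := fun h => hCC (congrArg Fin.val h)
      have h2 := hι2 C hC (fun h => hCM (congrArg Fin.val h))
      have h2' := hι2 C' hC' (fun h => hC'M (congrArg Fin.val h))
      exact ⟨hxsep C C' hne (Fin.ext (by rw [(hx2 C).2 h2, (hx2 C').2 h2'])),
        hχsep C C' hne (Fin.ext (by rw [(hy2 C).2 h2, (hy2 C').2 h2']))⟩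
  have pair1 : ∀ O O' : Fin (N * 2), (((γ ∘ ι) O : Fin N) : ℕ) = 1 → (((γ ∘ ι) O' : Fin N) : ℕ) = 1 →
      (O : ℕ) ≠ (O' : ℕ) → (O : ℕ) ≠ (one : ℕ) → (O' : ℕ) ≠ (one : ℕ) →
      (O : ℕ) % 2 ≠ (O' : ℕ) % 2 ∧ ((κ O : Fin (N * 2)) : ℕ) % 2 ≠ ((κ O' : Fin (N * 2)) : ℕ) % 2 :=
    fun O O' hO hO' hOO hO1 hO'1 => by
      have hne : O ≠ O' := fun h => hOO (congrArg Fin.val h)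
      have h3 := hι3 O hO (fun h => hO1 (congrArg Fin.val h))
      have h3' := hι3 O' hO' (fun h => hO'1 (congrArg Fin.val h))
      exact ⟨hxsep O O' hne (Fin.ext (by rw [(hx3 O).2 h3, (hx3 O').2 h3'])),
        hχsep O O' hne (Fin.ext (by rw [(hy3 O).2 h3, (hy3 O').2 h3']))⟩
  /- 5 · the double cross and the block-sign law -/
  have hA : e p0 = (0, ⟨0, by omega⟩) := Prod.ext (Fin.ext (by simp [(hev p0).1, hp0])) (Fin.ext (by simp [(hev p0).2, hp0]))
  have hB : e p1 = (1, ⟨0, by omega⟩) := Prod.ext (Fin.ext (by simp [(hev p1).1, hp1])) (Fin.ext (by simp [(hev p1).2, hp1]))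
  have hC : e p6 = (0, ⟨3, by omega⟩) :=
    Prod.ext (Fin.ext (by simp [(hev p6).1, hp6])) (Fin.ext (by simp [(hev p6).2, hp6]))
  have hD : e p7 = (1, ⟨3, by omega⟩) :=
    Prod.ext (Fin.ext (by simp [(hev p7).1, hp7])) (Fin.ext (by simp [(hev p7).2, hp7]))
  have hh : (⟨0, by omega⟩ : Fin N) ≠ ⟨3, by omega⟩ := Fin.ne_of_val_ne (by simp)
  have hζ := twist_blockSign_mul e hh hA hB hC hD κ hκ hφv hψv ι hpN hNu hpM hMu hx hχ
  rw [← mul_assoc, hζ, hval, ← Equiv.Perm.sign_symm π₀, ← Equiv.Perm.sign_symm π₁, ← Equiv.Perm.sign_symm π₂,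
    sign_perm_fin_four_eq π₀.symm, sign_perm_fin_three_eq π₁.symm, sign_perm_fin_three_eq π₂.symm, hz0, hz1, hz2,
    ← hnv]
  /- 6 · the finite sign model -/
  refine sign_combine' _ _ _ _ _ ?_ (threeThreeOne_model (pN : ℕ) (π₀.symm 2 : ℕ) (π₀.symm 1 : ℕ) (π₁.symm 2 : ℕ)
    (π₁.symm 1 : ℕ) (π₂.symm 2 : ℕ) (π₂.symm 1 : ℕ) jM j1 (by omega) b02 b01 b12 b11 b22 b21 hjM3 hj13
    (by rw [hnv]; exact hd0 3 2 (by decide)) (by rw [hnv]; exact hd0 3 1 (by decide)) (hd0 2 1 (by decide))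
    (hd1 2 1 (by decide)) (hd2 2 1 (by decide))
    ?_ ?_ ?_ ?_ ?_ ?_ ?_ ?_ ?_ ?_ ?_ ?_ ?_ ?_ ?_)
  · -- the toggling condition in coordinates
    rw [hjMv, hE pN pM, hE (κ pN) (κ pM), hκv pN, hκv pM]
  · intro hj; have := hMc.2.2 hj
    have h := (pair2 C0 C1 hwC0 hwC1 (by omega) (by omega) (by omega)).1; rwa [hC0, hC1] at h
  · intro hj; have := hMc.2.1 hj
    have h := (pair2 C0 C2 hwC0 hwC2 (by omega) (by omega) (by omega)).1; rwa [hC0, hC2] at h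
  · intro hj; have := hMc.1 hj
    have h := (pair2 C1 C2 hwC1 hwC2 (by omega) (by omega) (by omega)).1; rwa [hC1, hC2] at h
  · intro hj; have := hMc.2.2 hj
    have h := (pair2 C0 C1 hwC0 hwC1 (by omega) (by omega) (by omega)).2; rwa [hκv C0, hκv C1, hC0, hC1] at h
  · intro hj; have := hMc.2.1 hj
    have h := (pair2 C0 C2 hwC0 hwC2 (by omega) (by omega) (by omega)).2; rwa [hκv C0, hκv C2, hC0, hC2] at h
  · intro hj; have := hMc.1 hj
    have h := (pair2 C1 C2 hwC1 hwC2 (by omega) (by omega) (by omega)).2; rwa [hκv C1, hκv C2, hC1, hC2] at h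
  · intro hj; have := hOc.2.2 hj
    have h := (pair1 O0 O1 hwO0 hwO1 (by omega) (by omega) (by omega)).1; rwa [hO0, hO1] at h
  · intro hj; have := hOc.2.1 hj
    have h := (pair1 O0 O2 hwO0 hwO2 (by omega) (by omega) (by omega)).1; rwa [hO0, hO2] at h
  · intro hj; have := hOc.1 hj
    have h := (pair1 O1 O2 hwO1 hwO2 (by omega) (by omega) (by omega)).1; rwa [hO1, hO2] at h
  · intro hj; have := hOc.2.2 hj
    have h := (pair1 O0 O1 hwO0 hwO1 (by omega) (by omega) (by omega)).2; rwa [hκv O0, hκv O1, hO0, hO1] at h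
  · intro hj; have := hOc.2.1 hj
    have h := (pair1 O0 O2 hwO0 hwO2 (by omega) (by omega) (by omega)).2; rwa [hκv O0, hκv O2, hO0, hO2] at h
  · intro hj; have := hOc.1 hj
    have h := (pair1 O1 O2 hwO1 hwO2 (by omega) (by omega) (by omega)).2; rwa [hκv O1, hκv O2, hO1, hO2] at h
  · -- `p_M` and the `ι = 1` cell carry `φ∘ι = 1`
    rw [hjMv, hj1v]
    exact hxsep pM one honeM.symm (Fin.ext (by rw [(hx1 pM).2 (Or.inr hpM), hx1one]))
  · -- `p_N` and the `ι = 1` cell carry `ψ∘ι = 1`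
    rw [hj1v]
    have h := hχsep pN one hNone (Fin.ext (by rw [(hy1 pN).2 (Or.inr hpN), (hy1 one).2 (Or.inl hιone)]))
    rwa [hκv pN, hκv one] at h
  · -- not toggling
    rw [hjMv]
    rcases hsep with h | h
    · exact Or.inl ((hE pN pM).1 h)
    · have h' := (hE (κ pN) (κ pM)).1 h
      rw [hκv pN, hκv pM] at h'
      exact Or.inr h'

end Summit.MatrixMultiplication.MatrixMultiplication.Theorems.ObstructionCalculus

end
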